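import Summits.QuantumFields.YangMills.Theorems.DirichletWindowAllSidesChessboardEvenCore
import HarnessLib

/-!
# The twisted two-class chessboard estimate on a block torus of EVEN side — translations

Support file for item stmt-QuantumFields-20194 (`DirichletWindow.AllSidesCouplingChessboard`, K1 of the large-field
sparsity line; seat ym-dw-p1 g3).  Part 2 (of 3): the block translations `cellTranslate i a` conjugate the open
symmetrisations `symP/symM i k` of the tree and the site-type symmetrisations `ssymP/ssymM i j` of part 1 into the
same symmetrisations with parameter `k + a` (`j + a`).  On the gauge side this turns the two BASE reflection
Cauchy–Schwarz inequalities of the even torus (link reflection between the slices `0 | 1`, site reflection through the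
slice `0`) into the inequalities for every hyperplane, for a translation-invariant functional.  Finite combinatorics.

References: J. Fröhlich, R. Israel, E. H. Lieb, B. Simon, Comm. Math. Phys. 62 (1978) 1–34, Thm. 4.1; S. Friedli,
Y. Velenik, Statistical Mechanics of Lattice Systems (2017), §10.2.  Nothing here is a statement about the Yang–Mills gap.
-/

noncomputable section

open Finset
open Literature.Barriers.CriticalPhenomena.NonGibbs
open Literature.Probability.LatticeModels

namespace Summit.QuantumFields.YangMills.Theorems.AllSidesChessboard


/-! ### §4. Conjugating the symmetrisations by translations -/

section Translate

variable {d N : ℕ} [NeZero N]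

omit [NeZero N] in
/-- Translation conjugates `cellReflect i k` into `cellReflect i (k + a)`. -/
theorem cellTranslate_cellReflect (i : Fin d) (k a : ZMod N) (c : BlockIdx d N) :
    cellTranslate i a (cellReflect i k c) = cellReflect i (k + a) (cellTranslate i a c) := by
  ext l; by_cases h : l = i
  · subst h; simp only [cellTranslate_apply, cellReflect_apply, Function.update_self]; ring
  · simp [h]

omit [NeZero N] in
/-- Translation conjugates `sreflect i j` into `sreflect i (j + a)`. -/
theorem cellTranslate_sreflect (i : Fin d) (j a : ZMod N) (c : BlockIdx d N) :
    cellTranslate i a (sreflect i j c) = sreflect i (j + a) (cellTranslate i a c) := by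
  ext l; by_cases h : l = i
  · subst h; simp only [cellTranslate_apply, sreflect_apply, Function.update_self]; ring
  · simp [h]

omit [NeZero N] in
/-- The translated relative coordinate. -/
theorem cellTranslate_apply_sub (i : Fin d) (k a : ZMod N) (c : BlockIdx d N) :
    cellTranslate i a c i - (k + a) = c i - k := by
  simp only [cellTranslate_apply, Function.update_self]; ring

/-- **Translation conjugates the open positive symmetrisation**: `T_a (symP i k B) = symP i (k + a) (T_a B)`. -/
theorem image_cellTranslate_symP (i : Fin d) (k a : ZMod N) (B : Finset (BlockIdx d N)) :
    (symP i k B).image (cellTranslate i a) = symP i (k + a) (B.image (cellTranslate i a)) := by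
  ext c
  simp only [symP, mem_image, mem_union, mem_inter, mem_halfPlus]
  constructor
  · rintro ⟨b, hb, rfl⟩
    rcases hb with ⟨hbB, hbC⟩ | ⟨b', ⟨hb'B, hb'C⟩, rfl⟩
    · exact Or.inl ⟨⟨b, hbB, rfl⟩, by rwa [cellTranslate_apply_sub]⟩
    · refine Or.inr ⟨cellTranslate i a b', ⟨⟨b', hb'B, rfl⟩, by rwa [cellTranslate_apply_sub]⟩, ?_⟩
      rw [cellTranslate_cellReflect]
  · rintro (⟨⟨b, hbB, rfl⟩, hC⟩ | ⟨b', ⟨⟨b, hbB, rfl⟩, hbC⟩, rfl⟩)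
    · exact ⟨b, Or.inl ⟨hbB, by rwa [cellTranslate_apply_sub] at hC⟩, rfl⟩
    · refine ⟨cellReflect i k b, Or.inr ⟨b, ⟨hbB, by rwa [cellTranslate_apply_sub] at hbC⟩, rfl⟩, ?_⟩
      rw [cellTranslate_cellReflect]

/-- **Translation conjugates the open negative symmetrisation.** -/
theorem image_cellTranslate_symM (i : Fin d) (k a : ZMod N) (B : Finset (BlockIdx d N)) :
    (symM i k B).image (cellTranslate i a) = symM i (k + a) (B.image (cellTranslate i a)) := by
  ext c
  simp only [symM, mem_image, mem_union, mem_inter, mem_halfMinus]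
  constructor
  · rintro ⟨b, hb, rfl⟩
    rcases hb with ⟨hbB, hbC⟩ | ⟨b', ⟨hb'B, hb'C⟩, rfl⟩
    · exact Or.inl ⟨⟨b, hbB, rfl⟩, by rwa [cellTranslate_apply_sub]⟩
    · refine Or.inr ⟨cellTranslate i a b', ⟨⟨b', hb'B, rfl⟩, by rwa [cellTranslate_apply_sub]⟩, ?_⟩
      rw [cellTranslate_cellReflect]
  · rintro (⟨⟨b, hbB, rfl⟩, hC⟩ | ⟨b', ⟨⟨b, hbB, rfl⟩, hbC⟩, rfl⟩)
    · exact ⟨b, Or.inl ⟨hbB, by rwa [cellTranslate_apply_sub] at hC⟩, rfl⟩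
    · refine ⟨cellReflect i k b, Or.inr ⟨b, ⟨hbB, by rwa [cellTranslate_apply_sub] at hbC⟩, rfl⟩, ?_⟩
      rw [cellTranslate_cellReflect]

/-- **Translation conjugates the site-type positive symmetrisation.** -/
theorem image_cellTranslate_ssymP (i : Fin d) (j a : ZMod N) (B : Finset (BlockIdx d N)) :
    (ssymP i j B).image (cellTranslate i a) = ssymP i (j + a) (B.image (cellTranslate i a)) := by
  ext c
  simp only [ssymP, mem_image, mem_union, mem_inter, mem_shalfP]
  constructor
  · rintro ⟨b, hb, rfl⟩
    rcases hb with ⟨hbB, hbC⟩ | ⟨b', ⟨hb'B, hb'C⟩, rfl⟩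
    · exact Or.inl ⟨⟨b, hbB, rfl⟩, by rwa [cellTranslate_apply_sub]⟩
    · refine Or.inr ⟨cellTranslate i a b', ⟨⟨b', hb'B, rfl⟩, by rwa [cellTranslate_apply_sub]⟩, ?_⟩
      rw [cellTranslate_sreflect]
  · rintro (⟨⟨b, hbB, rfl⟩, hC⟩ | ⟨b', ⟨⟨b, hbB, rfl⟩, hbC⟩, rfl⟩)
    · exact ⟨b, Or.inl ⟨hbB, by rwa [cellTranslate_apply_sub] at hC⟩, rfl⟩
    · refine ⟨sreflect i j b, Or.inr ⟨b, ⟨hbB, by rwa [cellTranslate_apply_sub] at hbC⟩, rfl⟩, ?_⟩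
      rw [cellTranslate_sreflect]

/-- **Translation conjugates the site-type negative symmetrisation.** -/
theorem image_cellTranslate_ssymM (i : Fin d) (j a : ZMod N) (B : Finset (BlockIdx d N)) :
    (ssymM i j B).image (cellTranslate i a) = ssymM i (j + a) (B.image (cellTranslate i a)) := by
  ext c
  simp only [ssymM, mem_image, mem_union, mem_inter, mem_shalfM]
  constructor
  · rintro ⟨b, hb, rfl⟩
    rcases hb with ⟨hbB, hbC⟩ | ⟨b', ⟨hb'B, hb'C⟩, rfl⟩
    · exact Or.inl ⟨⟨b, hbB, rfl⟩, by rwa [cellTranslate_apply_sub]⟩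
    · refine Or.inr ⟨cellTranslate i a b', ⟨⟨b', hb'B, rfl⟩, by rwa [cellTranslate_apply_sub]⟩, ?_⟩
      rw [cellTranslate_sreflect]
  · rintro (⟨⟨b, hbB, rfl⟩, hC⟩ | ⟨b', ⟨⟨b, hbB, rfl⟩, hbC⟩, rfl⟩)
    · exact ⟨b, Or.inl ⟨hbB, by rwa [cellTranslate_apply_sub] at hC⟩, rfl⟩
    · refine ⟨sreflect i j b, Or.inr ⟨b, ⟨hbB, by rwa [cellTranslate_apply_sub] at hbC⟩, rfl⟩, ?_⟩
      rw [cellTranslate_sreflect]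

omit [NeZero N] in
/-- Translating the other components and back: `T_{-a} (T_a B) = B`. -/
theorem image_cellTranslate_neg_image (i : Fin d) (a : ZMod N) (B : Finset (BlockIdx d N)) :
    (B.image (cellTranslate i a)).image (cellTranslate i (-a)) = B := by
  rw [image_image]
  convert image_id (s := B) using 2
  funext c
  ext l; by_cases h : l = i
  · subst h; simp
  · simp [h]

end Translate

end Summit.QuantumFields.YangMills.Theorems.AllSidesChessboard

end
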